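import Mathlib.Algebra.Order.BigOperators.Group.Finset
import Mathlib.Algebra.Order.Floor.Defs
import Mathlib.Algebra.Order.Floor.Semiring
import Mathlib.Combinatorics.Enumerative.DoubleCounting
import Mathlib.Tactic
import HarnessLib

/-!
# Szemerédi's theorem (finitary statement) and Varnavides' averaging argument

Topic `Literature/Combinatorics/Additive` (next to Mathlib's `Combinatorics/Additive/AP/Three`, which
has the case `k = 3`, Roth's theorem, only).

* `SzemerediTheorem` — the NAMED FACT (D-0014): E. Szemerédi, *On sets of integers containing no
  `k` elements in arithmetic progression*, Acta Arith. 27 (1975), 199–245, Main Theorem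
  (`r_k(n) = o(n)`, the Erdős–Turán conjecture of 1936), in the finitary form printed as
  Theorem 1.2 of D. H. J. Polymath, Ann. of Math. 175 (2012), p. 1284: "For every positive integer
  `k` and every `δ > 0`, there exists `N` such that every subset `A ⊆ [N]` of size at least `δN`
  contains an arithmetic progression of length `k`" — here for all `N ≥ N₀`, which is literally
  `r_k(N) < δ N` for `N ≥ N₀(k, δ)`, i.e. `r_k(n) = o(n)`; `[N]` is rendered as `{0, …, N-1}`
  (`Finset.range N`; the statement is translation invariant) and "arithmetic progression of
  length `k`" as `a, a + d, …, a + (k-1)d` with `d ≥ 1`. This is also Green–Tao's Prop. 2.1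
  (Ann. of Math. 167 (2008), p. 483, stated there in `ℤ/Nℤ`). Mathlib has no Szemerédi theorem
  for `k ≥ 4`; the fact is to be discharged via the density Hales–Jewett theorem (session plan).
* PROVED from it, Varnavides' theorem `SzemerediTheorem.le_card_apPairs` (P. Varnavides,
  J. London Math. Soc. 34 (1959), 358–360): a `δ`-dense `A ⊆ {0, …, N-1}` contains `≥ c(k, δ) N²`
  progressions, by the classical averaging over the `M`-term subprogressions
  `a, a + d, …, a + (M-1)d`, `M = N₀(k, δ/2)`: for `d ≤ δN/(4M)` at least `δN/4` of the bases `a`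
  see `A` with relative density `≥ δ/2` (`le_card_goodBases`), each such block contains a
  progression of `A` by Szemerédi's theorem (`exists_witness`), and each progression of `A` is so
  obtained from at most `M²` blocks (`card_filter_goodPairs_le` and Mathlib's double counting
  `Finset.card_mul_le_card_mul`),
  whence `#apPairs ≥ δ² N² / (32 M³)` (`le_card_apPairs_of_two_le`).

This is the "combinatorial trickery (Varnavides [43])" by which Green–Tao (2008, p. 486) pass from
Prop. 2.1 to their Prop. 2.3; the passage to `ℤ/Nℤ` and to `[0,1]`-valued functions is done in
`Literature/NumberTheory/Sieve/GreenTao2008SzemerediExpectation.lean`.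

## References
* E. Szemerédi, Acta Arith. 27 (1975), 199–245, Main Theorem. [cite: Szemeredi1975]
* P. Varnavides, J. London Math. Soc. 34 (1959), 358–360, Theorem. [cite: Varnavides1959]
* D. H. J. Polymath, Ann. of Math. 175 (2012), 1283–1327, Thm. 1.2 (statement of Szemerédi's
  theorem as vendored). [cite: Polymath2012DHJ]
* B. Green, T. Tao, Ann. of Math. 167 (2008), Prop. 2.1 and p. 486. [cite: GreenTaoAnnals2008]
-/

open Finset

namespace Literature.Combinatorics.Additive

/-- **Szemerédi's theorem** (E. Szemerédi 1975, Main Theorem: `r_k(n) = o(n)`; finitary form as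
printed in Polymath, Ann. of Math. 175 (2012), Thm. 1.2, and Green–Tao 2008, Prop. 2.1): for every
positive integer `k` and every `δ > 0` there is `N₀` such that for all `N ≥ N₀`, every
`A ⊆ {0, …, N-1}` with `#A ≥ δ N` contains an arithmetic progression `a, a + d, …, a + (k-1) d`
with `d ≥ 1`. Named fact (not in Mathlib for `k ≥ 4`); users take `(h : SzemerediTheorem)`.
[cite: Szemeredi1975, Main Theorem] -/
def SzemerediTheorem : Prop :=
  ∀ k : ℕ, 1 ≤ k → ∀ δ : ℝ, 0 < δ → ∃ N₀ : ℕ, ∀ N : ℕ, N₀ ≤ N → ∀ A : Finset ℕ, A ⊆ range N →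
    δ * N ≤ #A → ∃ a d : ℕ, 0 < d ∧ ∀ i < k, a + i * d ∈ A

/-- The `k`-term arithmetic progressions `(a, d)`, `a, d < N`, `d ≥ 1`, contained in `A`, counted as
pairs (base, difference). For `k ≥ 2` and `A ⊆ {0, …, N-1}` the bounds `a, d < N` are automatic,
so this counts ALL nontrivial `k`-term progressions inside `A`; for `k ≤ 1` it counts `~ #A · N`
pairs (no content; `le_card_apPairs` below holds in both regimes via `apPairs_mono`). [folklore] -/
def apPairs (k N : ℕ) (A : Finset ℕ) : Finset (ℕ × ℕ) :=
  (range N ×ˢ range N).filter fun p => 0 < p.2 ∧ ∀ i < k, p.1 + i * p.2 ∈ A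

/-- Membership in `apPairs`. [folklore] -/
theorem mem_apPairs {k N : ℕ} {A : Finset ℕ} {p : ℕ × ℕ} :
    p ∈ apPairs k N A ↔ p.1 < N ∧ p.2 < N ∧ 0 < p.2 ∧ ∀ i < k, p.1 + i * p.2 ∈ A := by
  simp [apPairs, and_assoc]

/-- Longer progressions are fewer: `apPairs` is antitone in `k`. [folklore] -/
theorem apPairs_mono {k k' N : ℕ} (hk : k ≤ k') (A : Finset ℕ) : apPairs k' N A ⊆ apPairs k N A := by
  intro p hp
  rw [mem_apPairs] at hp ⊢
  exact ⟨hp.1, hp.2.1, hp.2.2.1, fun i hi => hp.2.2.2 i (lt_of_lt_of_le hi hk)⟩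

/-- Shift count: `#A ≤ #{a < N | a + s ∈ A} + s` for `A ⊆ range N`. [folklore] -/
theorem card_le_card_filter_add_shift {N : ℕ} {A : Finset ℕ} (hA : A ⊆ range N) (s : ℕ) :
    #A ≤ #((range N).filter fun a => a + s ∈ A) + s := by
  classical
  have hsub : A ⊆ ((range N).filter fun a => a + s ∈ A).image (· + s) ∪ range s := by
    intro x hx
    by_cases hxs : x < s
    · exact mem_union_right _ (mem_range.2 hxs)
    · refine mem_union_left _ (mem_image.2 ⟨x - s, ?_, Nat.sub_add_cancel (not_lt.1 hxs)⟩)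
      refine mem_filter.2 ⟨mem_range.2 ?_, ?_⟩
      · exact lt_of_le_of_lt (Nat.sub_le x s) (mem_range.1 (hA hx))
      · rwa [Nat.sub_add_cancel (not_lt.1 hxs)]
  calc #A ≤ #(((range N).filter fun a => a + s ∈ A).image (· + s) ∪ range s) := card_le_card hsub
    _ ≤ #(((range N).filter fun a => a + s ∈ A).image (· + s)) + #(range s) := card_union_le _ _
    _ ≤ #((range N).filter fun a => a + s ∈ A) + s :=
        Nat.add_le_add card_image_le (card_range s).le


namespace SzemerediTheorem

/-! ### Varnavides' averaging argument -/

/-- The block `B_{a,d} = {j < M | a + j d ∈ A}`: the trace of `A` on the `M`-term progression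
`a, a + d, …, a + (M-1)d`, pulled back to `{0, …, M-1}`. [cite: Varnavides1959, proof] -/
def block (M : ℕ) (A : Finset ℕ) (a d : ℕ) : Finset ℕ :=
  (range M).filter fun j => a + j * d ∈ A

/-- `B_{a,d} ⊆ {0, …, M-1}`. [folklore] -/
theorem block_subset (M : ℕ) (A : Finset ℕ) (a d : ℕ) : block M A a d ⊆ range M := filter_subset _ _

/-- `#B_{a,d} ≤ M`. [folklore] -/
theorem card_block_le (M : ℕ) (A : Finset ℕ) (a d : ℕ) : #(block M A a d) ≤ M :=
  (card_le_card (block_subset M A a d)).trans (card_range M).le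

/-- `∑_{a < N} #B_{a,d} = ∑_{j < M} #{a < N | a + j d ∈ A}`. [cite: Varnavides1959, proof] -/
theorem sum_card_block (M N : ℕ) (A : Finset ℕ) (d : ℕ) :
    ∑ a ∈ range N, #(block M A a d) = ∑ j ∈ range M, #((range N).filter fun a => a + j * d ∈ A) := by
  simp only [block, card_filter]
  exact sum_comm

/-- Lower bound `M #A ≤ ∑_{a < N} #B_{a,d} + M² d`. [cite: Varnavides1959, proof] -/
theorem mul_card_le_sum_card_block {N : ℕ} {A : Finset ℕ} (hA : A ⊆ range N) (M d : ℕ) :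
    M * #A ≤ ∑ a ∈ range N, #(block M A a d) + M * (M * d) := by
  rw [sum_card_block]
  have : ∀ j ∈ range M, #A ≤ #((range N).filter fun a => a + j * d ∈ A) + M * d := by
    intro j hj
    refine (card_le_card_filter_add_shift hA (j * d)).trans ?_
    gcongr
    exact (mem_range.1 hj).le
  calc M * #A = ∑ j ∈ range M, #A := by rw [sum_const, card_range, smul_eq_mul]
    _ ≤ ∑ j ∈ range M, (#((range N).filter fun a => a + j * d ∈ A) + M * d) := sum_le_sum this
    _ = ∑ j ∈ range M, #((range N).filter fun a => a + j * d ∈ A) + M * (M * d) := by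
        rw [sum_add_distrib, sum_const, card_range, smul_eq_mul]

/-- The good bases for difference `d`: those `a < N` whose block has density `≥ δ/2`.
[cite: Varnavides1959, proof] -/
noncomputable def goodBases (M N : ℕ) (δ : ℝ) (A : Finset ℕ) (d : ℕ) : Finset ℕ :=
  (range N).filter fun a => δ / 2 * M ≤ #(block M A a d)

/-- Upper bound `∑_{a < N} #B_{a,d} ≤ #good · M + N · (δ/2) M`. [cite: Varnavides1959, proof] -/
theorem sum_card_block_le {M N : ℕ} {δ : ℝ} (hδ : 0 ≤ δ) (A : Finset ℕ) (d : ℕ) :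
    (∑ a ∈ range N, (#(block M A a d) : ℝ)) ≤ #(goodBases M N δ A d) * M + N * (δ / 2 * M) := by
  classical
  rw [← sum_filter_add_sum_filter_not (range N) (fun a => δ / 2 * M ≤ (#(block M A a d) : ℝ))]
  refine add_le_add ?_ ?_
  · calc ∑ a ∈ (range N).filter (fun a => δ / 2 * M ≤ (#(block M A a d) : ℝ)), (#(block M A a d) : ℝ)
          ≤ ∑ a ∈ (range N).filter (fun a => δ / 2 * M ≤ (#(block M A a d) : ℝ)), (M : ℝ) :=
            sum_le_sum fun a _ => by exact_mod_cast card_block_le M A a d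
      _ = #(goodBases M N δ A d) * M := by rw [sum_const, nsmul_eq_mul]; rfl
  · calc ∑ a ∈ (range N).filter (fun a => ¬ δ / 2 * M ≤ (#(block M A a d) : ℝ)), (#(block M A a d) : ℝ)
          ≤ ∑ a ∈ (range N).filter (fun a => ¬ δ / 2 * M ≤ (#(block M A a d) : ℝ)), δ / 2 * M :=
            sum_le_sum fun a ha => (not_le.1 (mem_filter.1 ha).2).le
      _ = #((range N).filter (fun a => ¬ δ / 2 * M ≤ (#(block M A a d) : ℝ))) * (δ / 2 * M) := by
            rw [sum_const, nsmul_eq_mul]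
      _ ≤ N * (δ / 2 * M) := by
            gcongr
            exact_mod_cast (card_le_card (filter_subset _ _)).trans (card_range N).le

/-- For `1 ≤ M`, `M d ≤ δ N / 4` and `#A ≥ δ N`: at least `δ N / 4` good bases.
[cite: Varnavides1959, proof] -/
theorem le_card_goodBases {M N : ℕ} {δ : ℝ} {A : Finset ℕ} (hA : A ⊆ range N) (hδ : 0 ≤ δ)
    (hM : 1 ≤ M) (hcard : δ * N ≤ #A) {d : ℕ} (hd : (M : ℝ) * d ≤ δ * N / 4) :
    δ * N / 4 ≤ #(goodBases M N δ A d) := by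
  have h1 : (M : ℝ) * #A ≤ (∑ a ∈ range N, (#(block M A a d) : ℝ)) + M * (M * d) := by
    exact_mod_cast mul_card_le_sum_card_block hA M d
  have h2 := sum_card_block_le (M := M) (N := N) hδ A d
  have hM' : (0 : ℝ) < M := by exact_mod_cast hM
  have h3 : (M : ℝ) * (#A - M * d - N * (δ / 2)) ≤ M * #(goodBases M N δ A d) := by nlinarith
  have h4 : (#A : ℝ) - M * d - N * (δ / 2) ≤ #(goodBases M N δ A d) := le_of_mul_le_mul_left h3 hM'
  linarith

/-- The good pairs `(a, d)`, `a < N`, `1 ≤ d ≤ D`, whose block has density `≥ δ/2`.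
[cite: Varnavides1959, proof] -/
noncomputable def goodPairs (M N D : ℕ) (δ : ℝ) (A : Finset ℕ) : Finset (ℕ × ℕ) :=
  (range N ×ˢ Icc 1 D).filter fun p => δ / 2 * M ≤ #(block M A p.1 p.2)

/-- `#good pairs = ∑_{1 ≤ d ≤ D} #good bases for d`. [cite: Varnavides1959, proof] -/
theorem card_goodPairs (M N D : ℕ) (δ : ℝ) (A : Finset ℕ) :
    #(goodPairs M N D δ A) = ∑ d ∈ Icc 1 D, #(goodBases M N δ A d) := by
  simp only [goodPairs, goodBases, card_filter]
  exact sum_product_right (s := range N) (t := Icc 1 D)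
    (f := fun p : ℕ × ℕ => if δ / 2 * M ≤ (#(block M A p.1 p.2) : ℝ) then 1 else 0)

/-- At least `D · δ N / 4` good pairs when `M D ≤ δ N / 4`. [cite: Varnavides1959, proof] -/
theorem le_card_goodPairs {M N D : ℕ} {δ : ℝ} {A : Finset ℕ} (hA : A ⊆ range N) (hδ : 0 ≤ δ)
    (hM : 1 ≤ M) (hcard : δ * N ≤ #A) (hD : (M : ℝ) * D ≤ δ * N / 4) :
    (D : ℝ) * (δ * N / 4) ≤ #(goodPairs M N D δ A) := by
  rw [card_goodPairs, Nat.cast_sum]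
  have : ∀ d ∈ Icc 1 D, δ * N / 4 ≤ (#(goodBases M N δ A d) : ℝ) := by
    intro d hd
    refine le_card_goodBases hA hδ hM hcard (le_trans ?_ hD)
    gcongr
    exact_mod_cast (mem_Icc.1 hd).2
  calc (D : ℝ) * (δ * N / 4) = ∑ d ∈ Icc 1 D, δ * N / 4 := by
        rw [sum_const, Nat.card_Icc, nsmul_eq_mul]; push_cast; ring
    _ ≤ ∑ d ∈ Icc 1 D, (#(goodBases M N δ A d) : ℝ) := sum_le_sum this

/-- Szemerédi's theorem on a good block yields a `k`-term progression of `A` inside the long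
progression: base `a + a' d`, difference `d d'` with `a' < M`, `0 < d' < M`.
[cite: Varnavides1959, proof] -/
theorem exists_witness {k M : ℕ} {δ : ℝ} {A : Finset ℕ} (hk : 2 ≤ k)
    (hSz : ∀ B : Finset ℕ, B ⊆ range M → δ / 2 * M ≤ #B → ∃ a d : ℕ, 0 < d ∧ ∀ i < k, a + i * d ∈ B)
    {a d : ℕ} (ha : δ / 2 * M ≤ #(block M A a d)) :
    ∃ q ∈ (range M ×ˢ range M).filter (fun q : ℕ × ℕ => 0 < q.2),
      ∀ i < k, a + q.1 * d + i * (d * q.2) ∈ A := by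
  obtain ⟨a', d', hd', hmem⟩ := hSz (block M A a d) (block_subset M A a d) ha
  have h0 := hmem 0 (by omega)
  have h1 := hmem 1 (by omega)
  simp only [block, mem_filter, mem_range, zero_mul, add_zero, one_mul] at h0 h1
  refine ⟨(a', d'), mem_filter.2 ⟨mem_product.2 ⟨mem_range.2 h0.1, mem_range.2 (by omega)⟩, hd'⟩, ?_⟩
  intro i hi
  have := hmem i hi
  simp only [block, mem_filter, mem_range] at this
  have e : a + a' * d + i * (d * d') = a + (a' + i * d') * d := by ring
  rw [e]
  exact this.2

/-- Double counting, in the form used below: if every `a ∈ s` is related to some `b ∈ t` and every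
`b ∈ t` to at most `n` elements of `s`, then `#s ≤ #t · n`. A thin wrapper (case `m = 1`) around
Mathlib's `Finset.card_mul_le_card_mul`. [folklore] -/
theorem card_le_card_mul_of_rel {α β : Type*} (s : Finset α) (t : Finset β) (r : α → β → Prop)
    [∀ a b, Decidable (r a b)] (n : ℕ) (h1 : ∀ a ∈ s, ∃ b ∈ t, r a b)
    (h2 : ∀ b ∈ t, #(s.filter (r · b)) ≤ n) : #s ≤ #t * n := by
  have h := card_mul_le_card_mul (s := s) (t := t) r (m := 1) (n := n)
    (fun a ha => by
      obtain ⟨b, hb, hab⟩ := h1 a ha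
      exact card_pos.2 ⟨b, (mem_bipartiteAbove _).2 ⟨hb, hab⟩⟩) h2
  rwa [Nat.mul_one] at h

/-- For a fixed inner progression `(a', d')` with `d' > 0`, the outer pair `(a, d)` is determined by
the resulting progression `(a + a' d, d d')`: the good pairs producing progressions of `A` via
`(a', d')` inject into `apPairs k N A`. [cite: Varnavides1959, proof] -/
theorem card_filter_goodPairs_le {k M N D : ℕ} {δ : ℝ} {A : Finset ℕ} (hA : A ⊆ range N) (hk : 1 ≤ k)
    (hDM : D * M ≤ N) {q : ℕ × ℕ} (hq : q ∈ (range M ×ˢ range M).filter (fun q : ℕ × ℕ => 0 < q.2)) :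
    #((goodPairs M N D δ A).filter fun p => ∀ i < k, p.1 + q.1 * p.2 + i * (p.2 * q.2) ∈ A) ≤
      #(apPairs k N A) := by
  classical
  obtain ⟨hqM, hq2⟩ := mem_filter.1 hq
  have hq2M : q.2 < M := mem_range.1 (mem_product.1 hqM).2
  refine card_le_card_of_injOn (fun p => (p.1 + q.1 * p.2, p.2 * q.2)) ?_ ?_
  · intro p hp
    obtain ⟨hpg, hr⟩ := mem_filter.1 hp
    have hp2 : p.2 ∈ Icc 1 D := (mem_product.1 (mem_filter.1 hpg).1).2
    rw [mem_Icc] at hp2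
    rw [mem_coe, mem_apPairs]
    refine ⟨?_, ?_, Nat.mul_pos (by omega) hq2, hr⟩
    · have := hr 0 (by omega)
      rw [zero_mul, add_zero] at this
      exact mem_range.1 (hA this)
    · calc p.2 * q.2 < p.2 * M := Nat.mul_lt_mul_of_pos_left hq2M (by omega)
        _ ≤ D * M := Nat.mul_le_mul_right _ hp2.2
        _ ≤ N := hDM
  · intro p _ p' _ hpp
    simp only [Prod.mk.injEq] at hpp
    have h2 : p.2 = p'.2 := Nat.eq_of_mul_eq_mul_right hq2 hpp.2
    have h1 : p.1 = p'.1 := by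
      have := hpp.1
      rw [h2] at this
      omega
    exact Prod.ext h1 h2

/-- **Varnavides' theorem from Szemerédi's theorem**, `k ≥ 2`: a `δ`-dense `A ⊆ {0,…,N-1}`
contains at least `c(k, δ) N²` `k`-term progressions, `c = δ²/(32 M³)` with
`M = max(N₀(k, δ/2), 1)`. [cite: Varnavides1959, Theorem] -/
theorem le_card_apPairs_of_two_le (h : SzemerediTheorem) {k : ℕ} (hk : 2 ≤ k) {δ : ℝ}
    (hδ : 0 < δ) :
    ∃ c : ℝ, 0 < c ∧ ∃ N₀ : ℕ, ∀ N : ℕ, N₀ ≤ N → ∀ A : Finset ℕ, A ⊆ range N → δ * N ≤ #A →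
      c * (N : ℝ) ^ 2 ≤ #(apPairs k N A) := by
  classical
  obtain ⟨M₀, hM₀⟩ := h k (by omega) (δ / 2) (by positivity)
  set M : ℕ := max M₀ 1 with hMdef
  have hM1 : 1 ≤ M := le_max_right _ _
  have hMpos : (0 : ℝ) < M := by exact_mod_cast hM1
  have hSz : ∀ B : Finset ℕ, B ⊆ range M → δ / 2 * M ≤ #B →
      ∃ a d : ℕ, 0 < d ∧ ∀ i < k, a + i * d ∈ B := hM₀ M (le_max_left _ _)
  refine ⟨δ ^ 2 / (32 * (M : ℝ) ^ 3), by positivity, ⌈8 * M / δ⌉₊, fun N hN A hA hcard => ?_⟩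
  -- basic size facts
  have h8M : 8 * (M : ℝ) ≤ δ * N := by
    have h1 : 8 * (M : ℝ) / δ ≤ N := (Nat.le_ceil _).trans (by exact_mod_cast hN)
    rw [div_le_iff₀ hδ] at h1
    linarith
  have hNpos : (0 : ℝ) < N := by
    by_contra hcon
    push Not at hcon
    nlinarith
  have hδ1 : δ ≤ 1 := by
    have hAN : (#A : ℝ) ≤ N := by exact_mod_cast (card_le_card hA).trans (card_range N).le
    by_contra hcon
    push Not at hcon
    nlinarith
  -- the range of differences
  set D : ℕ := ⌊δ * N / (4 * M)⌋₊ with hDdef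
  have hDle : (D : ℝ) ≤ δ * N / (4 * M) := Nat.floor_le (by positivity)
  have hDge : δ * N / (8 * M) ≤ D := by
    have h1 : δ * N / (4 * M) - 1 < D := Nat.sub_one_lt_floor _
    have h2 : (1 : ℝ) ≤ δ * N / (8 * M) := by
      rw [le_div_iff₀ (by positivity)]; linarith
    have h3 : δ * N / (4 * M) = 2 * (δ * N / (8 * M)) := by ring
    linarith
  have hMD : (M : ℝ) * D ≤ δ * N / 4 := by
    calc (M : ℝ) * D ≤ M * (δ * N / (4 * M)) := by gcongr
      _ = δ * N / 4 := by field_simp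
  have hDM : D * M ≤ N := by
    have : (D : ℝ) * M ≤ N := by nlinarith
    exact_mod_cast this
  -- lower bound for the good pairs
  have hgood := le_card_goodPairs (D := D) hA hδ.le hM1 hcard hMD
  -- upper bound for the good pairs by double counting
  set Q : Finset (ℕ × ℕ) := (range M ×ˢ range M).filter (fun q : ℕ × ℕ => 0 < q.2) with hQdef
  have hQ : #Q ≤ M * M := (card_le_card (filter_subset _ _)).trans (by rw [card_product, card_range])
  have hcount : #(goodPairs M N D δ A) ≤ #Q * #(apPairs k N A) := by
    refine card_le_card_mul_of_rel (goodPairs M N D δ A) Q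
      (fun p q => ∀ i < k, p.1 + q.1 * p.2 + i * (p.2 * q.2) ∈ A) _ ?_ ?_
    · intro p hp
      exact exists_witness hk hSz (mem_filter.1 hp).2
    · intro q hq
      exact card_filter_goodPairs_le hA (by omega) hDM hq
  have hcountR : (#(goodPairs M N D δ A) : ℝ) ≤ (M : ℝ) ^ 2 * #(apPairs k N A) := by
    have h1 : (#(goodPairs M N D δ A) : ℝ) ≤ #Q * #(apPairs k N A) := by exact_mod_cast hcount
    have h2 : (#Q : ℝ) ≤ (M : ℝ) ^ 2 := by rw [sq]; exact_mod_cast hQ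
    nlinarith [Nat.cast_nonneg (α := ℝ) #(apPairs k N A)]
  -- combine
  have hmain : δ * N / (8 * M) * (δ * N / 4) ≤ (M : ℝ) ^ 2 * #(apPairs k N A) := by
    calc δ * N / (8 * M) * (δ * N / 4) ≤ (D : ℝ) * (δ * N / 4) := by gcongr
      _ ≤ #(goodPairs M N D δ A) := hgood
      _ ≤ (M : ℝ) ^ 2 * #(apPairs k N A) := hcountR
  have e : δ ^ 2 / (32 * (M : ℝ) ^ 3) * (N : ℝ) ^ 2 =
      (δ * N / (8 * M) * (δ * N / 4)) / (M : ℝ) ^ 2 := by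
    field_simp; ring
  rw [e, div_le_iff₀ (by positivity)]
  linarith

/-- **Varnavides' theorem from Szemerédi's theorem** (P. Varnavides, J. London Math. Soc. 34
(1959); the "combinatorial trickery" of Green–Tao 2008, p. 486): for every `k` and `δ > 0`
there are `c(k, δ) > 0` and `N₀` such that every `A ⊆ {0, …, N-1}`, `N ≥ N₀`, with `#A ≥ δ N`
contains at least `c N²` arithmetic progressions `a, a+d, …, a+(k-1)d` with `d ≥ 1` (counted as
pairs `(a, d)`). [cite: Varnavides1959, Theorem] -/
theorem le_card_apPairs (h : SzemerediTheorem) (k : ℕ) {δ : ℝ} (hδ : 0 < δ) :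
    ∃ c : ℝ, 0 < c ∧ ∃ N₀ : ℕ, ∀ N : ℕ, N₀ ≤ N → ∀ A : Finset ℕ, A ⊆ range N → δ * N ≤ #A →
      c * (N : ℝ) ^ 2 ≤ #(apPairs k N A) := by
  obtain ⟨c, hc, N₀, hN₀⟩ := le_card_apPairs_of_two_le h (le_max_right k 2) hδ
  refine ⟨c, hc, N₀, fun N hN A hA hcard => (hN₀ N hN A hA hcard).trans ?_⟩
  exact_mod_cast card_le_card (apPairs_mono (le_max_left k 2) A)

end SzemerediTheorem

end Literature.Combinatorics.Additive
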